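import Summits.NavierStokesRegularity.NavierStokesRegularity.Theorems.SoloSalvageWu2026WeakProduct
import HarnessLib

/-!
# C177 `Wu2026` — Prop 3.3 toolkit (part 4): the product rule `∇(|V|²/2) = (∇V)ᵀV` with two
# exponents

D-0090 NS-CLAIMS sweep, claim C177 (W. Wu, arXiv:2608.22471v1), skeleton
`Literature/Claims/NS/Wu2026.lean`; kernel objects for the binder `hP33` of `claim_of_steps''`
(Proposition 3.3 p.20, `Step_P33`). The printed proof: «V ∈ W^{1,9/5}(U) ∩ L^{9/2}(U) …
(3.53) … ∇Q = V × curl V (3.52) … By the Sobolev chain and product rules, see, for example, [1]»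
(p.20 l.40–105): `∇(|V|²/2) = (∇V)ᵀV` with the pairing `2/9 + 5/9 = 7/9 ≤ 1`. In the vocabulary
of `Literature.Analysis.FunctionSpaces.HasWeakFDerivOn`, with the exponent pairing
`1/p + 1/p' = 1` (`p = 9/2`, `p' = 9/7 ⊃ L^{9/5}` locally):

* `hasWeakFDerivOn_half_norm_sq` — `V ∈ L^p ∩ L^{p'}(Ω)`, `DV ∈ L^{p'}(Ω)` weakly ⟹ `|V|²/2`
  has the weak derivative `w ↦ ⟪V, DV w⟫` (the tree's `hasWeakFDerivOn_norm_sq` is the `W^{1,2}`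
  case; proof: mollify `V` (part 2), product rule with the smooth factor (part 3), Hölder limits
  (part 1)).

Seat ns-in-wu-p33 (cell pub/ns-inputs, D-0154 (2) INPUTS). WHAT THIS IS NOT: not a claim about
NS regularity or blow-up; no summit statement is proved here.
-/

noncomputable section

set_option linter.dupNamespace false

open MeasureTheory TopologicalSpace Set Function Filter Topology Metric
open scoped ENNReal NNReal Topology ContDiff RealInnerProductSpace

namespace Summit.NavierStokesRegularity.NavierStokesRegularity.Theorems.Wu2026Salvage

open Literature.Analysis.FunctionSpaces

variable {E : Type*} [NormedAddCommGroup E] [InnerProductSpace ℝ E] [FiniteDimensional ℝ E]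
  [MeasurableSpace E] [BorelSpace E] {μ : Measure E} [μ.IsAddHaarMeasure]
variable {F : Type*} [NormedAddCommGroup F] [NormedSpace ℝ F] [CompleteSpace F]

/-! ### The product rule `D(|V|²/2) = ⟪V, DV·⟫` with the exponent pairing `(p, p')` -/

section NormSq

variable {H : Type*} [NormedAddCommGroup H] [InnerProductSpace ℝ H] [FiniteDimensional ℝ H]

/-- **Product rule for `|V|²/2` with two exponents** (Evans, *PDE*, §5.2.3 Thm. 1 (iv); the
tree's `hasWeakFDerivOn_norm_sq` is the `W^{1,2}` case): if `V ∈ L^p(Ω) ∩ L^{p'}(Ω)` has the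
weak derivative `DV ∈ L^{p'}(Ω)` on `Ω` with `1/p + 1/p' = 1`, `1 ≤ p, p' < ∞`, then `|V|²/2` has
the weak derivative `w ↦ ⟪V, DV w⟫` on `Ω`. In Prop 3.3: `V ∈ L^{9/2}`, `∇V ∈ L^{9/5} ⊂ L^{9/7}`
locally on `{|y| > 1}` and `∇(|V|²/2) = (∇V)ᵀV` (p.20 l.45–55). Proof: mollify `V` (part 2),
apply `inner_contDiff_left` with the smooth factor `Vₙ`, pass to the limit (part 1).
[cite: Wu2026, Prop 3.3 proof p.20 l.45–55] -/
theorem hasWeakFDerivOn_half_norm_sq {Ω : Opens E} {V : E → H} {gV : E → E →L[ℝ] H}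
    {p p' : ℝ≥0∞} [ENNReal.HolderTriple p p' 1] (hp : 1 ≤ p) (hp' : p ≠ ⊤) (hq : 1 ≤ p')
    (hq' : p' ≠ ⊤) (hV : HasWeakFDerivOn Ω μ V gV) (hVp : MemLp V p (μ.restrict Ω))
    (hVp' : MemLp V p' (μ.restrict Ω)) (hGp' : MemLp gV p' (μ.restrict Ω)) :
    HasWeakFDerivOn Ω μ (fun x => ‖V x‖ ^ 2 / 2) (fun x => (innerSL ℝ (V x)).comp (gV x)) := by
  haveI : CompleteSpace H := FiniteDimensional.complete ℝ H
  have hVm : AEStronglyMeasurable V (μ.restrict Ω) := hVp.1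
  have hGm : AEStronglyMeasurable gV (μ.restrict Ω) := hGp'.1
  -- measurability of the candidate derivative (as a function of the pair `(DV, V)`)
  have hDm' : ∀ {ν : Measure E}, AEStronglyMeasurable V ν → AEStronglyMeasurable gV ν →
      AEStronglyMeasurable (fun x => (innerSL ℝ (V x)).comp (gV x)) ν := by
    intro ν h1 h2
    have h3 : AEStronglyMeasurable (fun x => innerSL ℝ (V x)) ν :=
      (innerSL ℝ (E := H)).continuous.comp_aestronglyMeasurable h1
    exact (isBoundedBilinearMap_comp (𝕜 := ℝ) (E := E) (F := H) (G := ℝ)).continuous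
      |>.comp_aestronglyMeasurable (h3.prodMk h2)
  have hsqm : ∀ {ν : Measure E}, AEStronglyMeasurable V ν →
      AEStronglyMeasurable (fun x => ‖V x‖ ^ 2 / 2) ν := fun h1 =>
    (by fun_prop : Continuous fun v : H => ‖v‖ ^ 2 / 2).comp_aestronglyMeasurable h1
  refine ⟨?_, ?_, fun φ w hφ => ?_⟩
  · -- `|V|²/2 ∈ L¹(Ω)`
    refine IntegrableOn.locallyIntegrableOn (integrable_of_norm_le_mul (p := p) (q := p')
      (C := 1 / 2) (μ := μ.restrict Ω) (P := fun x => ‖V x‖ ^ 2 / 2) (hsqm hVm) hVp hVp'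
      fun x => ?_)
    rw [Real.norm_of_nonneg (by positivity)]; ring_nf; rfl
  · -- `⟪V, DV·⟫ ∈ L¹(Ω)`
    refine IntegrableOn.locallyIntegrableOn (integrable_of_norm_le_mul (p := p') (q := p)
      (C := 1) (μ := μ.restrict Ω) (P := fun x => (innerSL ℝ (V x)).comp (gV x)) (hDm' hVm hGm)
      hGp' hVp fun x => ?_)
    rw [one_mul]
    refine (ContinuousLinearMap.opNorm_comp_le _ _).trans ?_
    rw [innerSL_apply_norm, mul_comm]
  · -- the identity, by approximation
    set K : Set E := tsupport φ with hK_def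
    have hK : IsCompact K := hφ.hasCompactSupport
    have hKΩ : K ⊆ (Ω : Set E) := hφ.tsupport_subset
    obtain ⟨Vn, hVs, hVnp, hVnq, -⟩ :=
      exists_smooth_approx_two_exponents hV hp hp' hq hq' hVp hGp' hK hKΩ
    have hφc : Continuous φ := hφ.contDiff.continuous
    have hDφc : Continuous (fderiv ℝ φ) := hφ.contDiff.continuous_fderiv (by simp)
    obtain ⟨Cφ, hCφ⟩ := hφc.bounded_above_of_compact_support hφ.hasCompactSupport
    obtain ⟨CDφ, hCDφ⟩ := hDφc.bounded_above_of_compact_support (hφ.hasCompactSupport.fderiv ℝ)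
    set ν : Measure E := μ.restrict K with hν
    haveI : IsFiniteMeasure ν :=
      ⟨by rw [hν, Measure.restrict_apply_univ]; exact hK.measure_lt_top⟩
    have hνΩ : ν ≤ μ.restrict (Ω : Set E) := Measure.restrict_mono hKΩ le_rfl
    have hVpν : MemLp V p ν := hVp.mono_measure hνΩ
    have hVp'ν : MemLp V p' ν := hVp'.mono_measure hνΩ
    have hGν : MemLp gV p' ν := hGp'.mono_measure hνΩ
    have hVmν : AEStronglyMeasurable V ν := hVpν.1
    have hGmν : AEStronglyMeasurable gV ν := hGν.1
    have hVnc : ∀ n, Continuous (Vn n) := fun n => (hVs n).continuous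
    have hDVnc : ∀ n, Continuous (fderiv ℝ (Vn n)) := fun n =>
      (hVs n).continuous_fderiv (by simp)
    have hVnpν : ∀ n, MemLp (Vn n) p ν := fun n =>
      memLp_restrict_of_continuous_isCompact (hVnc n) hK p
    have hDVnν : ∀ n, MemLp (fderiv ℝ (Vn n)) p' ν := fun n =>
      memLp_restrict_of_continuous_isCompact (hDVnc n) hK p'
    -- weights
    have hω₁ : MemLp (fun x => (fderiv ℝ φ x w) • V x) p' ν := by
      refine hVp'ν.of_le_mul ((hDφc.clm_apply continuous_const).aestronglyMeasurable.smul hVmν)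
        (c := CDφ * ‖w‖) (Eventually.of_forall fun x => ?_)
      rw [norm_smul]
      refine mul_le_mul_of_nonneg_right (((fderiv ℝ φ x).le_opNorm w).trans ?_) (norm_nonneg _)
      exact mul_le_mul_of_nonneg_right (hCDφ x) (norm_nonneg _)
    have hω₂ : MemLp (fun x => φ x • gV x w) p' ν := by
      refine hGν.of_le_mul (hφc.aestronglyMeasurable.smul
        (aestronglyMeasurable_clm_apply hGmν aestronglyMeasurable_const)) (c := Cφ * ‖w‖)
        (Eventually.of_forall fun x => ?_)
      rw [norm_smul]
      calc ‖φ x‖ * ‖gV x w‖ ≤ Cφ * (‖gV x‖ * ‖w‖) :=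
            mul_le_mul (hCφ x) ((gV x).le_opNorm w) (norm_nonneg _) ((norm_nonneg _).trans (hCφ x))
        _ = Cφ * ‖w‖ * ‖gV x‖ := by ring
    have hω₃ : MemLp (fun x => φ x • V x) p ν := by
      refine hVpν.of_le_mul (hφc.aestronglyMeasurable.smul hVmν) (c := Cφ)
        (Eventually.of_forall fun x => ?_)
      rw [norm_smul]; exact mul_le_mul_of_nonneg_right (hCφ x) (norm_nonneg _)
    -- the per-`n` identity (product rule with the smooth factor `Vₙ`), on `ν`
    have hφ0 : ∀ x, x ∉ K → φ x = 0 := fun x hx => image_eq_zero_of_notMem_tsupport hx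
    have hDφ0 : ∀ x, x ∉ K → fderiv ℝ φ x = 0 := fun x hx => fderiv_of_notMem_tsupport ℝ hx
    have hI1 : ∀ n, Integrable (fun x => φ x * ⟪Vn n x, gV x w⟫) ν := fun n =>
      integrable_of_norm_le_mul (p := p) (q := p') (C := 1)
        (hφc.aestronglyMeasurable.mul ((hVnc n).aestronglyMeasurable.inner
          (aestronglyMeasurable_clm_apply hGmν aestronglyMeasurable_const))) (hVnpν n) hω₂
        fun x => by
          rw [one_mul, norm_mul, norm_smul, mul_left_comm]
          exact mul_le_mul_of_nonneg_left (norm_inner_le_norm _ _) (norm_nonneg _)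
    have hI2 : ∀ n, Integrable (fun x => φ x * ⟪V x, fderiv ℝ (Vn n) x w⟫) ν := fun n =>
      integrable_of_norm_le_mul (p := p') (q := p) (C := ‖w‖)
        (hφc.aestronglyMeasurable.mul (hVmν.inner
          (aestronglyMeasurable_clm_apply (hDVnc n).aestronglyMeasurable aestronglyMeasurable_const)))
        (hDVnν n) hω₃ fun x => by
          rw [norm_mul, norm_smul, real_inner_comm]
          calc ‖φ x‖ * ‖⟪fderiv ℝ (Vn n) x w, V x⟫‖
              ≤ ‖φ x‖ * (‖fderiv ℝ (Vn n) x‖ * ‖w‖ * ‖V x‖) :=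
                mul_le_mul_of_nonneg_left ((norm_inner_le_norm _ _).trans
                  (mul_le_mul_of_nonneg_right ((fderiv ℝ (Vn n) x).le_opNorm w) (norm_nonneg _)))
                  (norm_nonneg _)
            _ = ‖w‖ * (‖fderiv ℝ (Vn n) x‖ * (‖φ x‖ * ‖V x‖)) := by ring
    have hstep : ∀ n, ∫ x, (fderiv ℝ φ x w) * ⟪Vn n x, V x⟫ ∂ν =
        -(∫ x, φ x * ⟪Vn n x, gV x w⟫ ∂ν + ∫ x, φ x * ⟪V x, fderiv ℝ (Vn n) x w⟫ ∂ν) := by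
      intro n
      have h := (hasWeakFDerivOn_inner_contDiff_left hV (hVs n)).integral_fderiv_smul_eq φ w hφ
      have hL0 : ∀ x, x ∉ K → (fderiv ℝ φ x w) • ⟪Vn n x, V x⟫ = 0 := fun x hx => by
        rw [hDφ0 x hx, zero_apply, zero_smul]
      have hR0 : ∀ x, x ∉ K → φ x • ((innerSL ℝ (Vn n x)).comp (gV x) +
          (innerSL ℝ (V x)).comp (fderiv ℝ (Vn n) x)) w = 0 := fun x hx => by
        rw [hφ0 x hx, zero_smul]
      rw [setIntegral_eq_setIntegral_of_forall_notMem_eq_zero hL0 hKΩ,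
        setIntegral_eq_setIntegral_of_forall_notMem_eq_zero hR0 hKΩ] at h
      simp only [smul_eq_mul, add_apply, ContinuousLinearMap.comp_apply, innerSL_apply_apply,
        mul_add] at h
      rw [integral_add (hI1 n) (hI2 n)] at h
      exact h
    -- limits of the three pairings
    have hlimL : Tendsto (fun n => ∫ x, (fderiv ℝ φ x w) * ⟪Vn n x, V x⟫ ∂ν) atTop
        (𝓝 (∫ x, (fderiv ℝ φ x w) * ⟪V x, V x⟫ ∂ν)) := by
      refine tendsto_integral_of_norm_sub_le_mul (p := p) (q := p') (C := 1)
        (fun n => (hDφc.clm_apply continuous_const).aestronglyMeasurable.mul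
          ((hVnc n).aestronglyMeasurable.inner hVmν))
        (integrable_of_norm_le_mul (p := p) (q := p') (C := 1)
          ((hDφc.clm_apply continuous_const).aestronglyMeasurable.mul (hVmν.inner hVmν))
          hVpν hω₁ fun x => ?_)
        (fun n => (hVnc n).aestronglyMeasurable) hVmν hω₁ (fun n x => ?_) ?_
      · rw [one_mul, norm_mul, norm_smul, mul_left_comm, real_inner_comm]
        exact mul_le_mul_of_nonneg_left (norm_inner_le_norm _ _) (norm_nonneg _)
      · rw [← mul_sub, ← inner_sub_left, one_mul, norm_mul, norm_smul, mul_left_comm]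
        exact mul_le_mul_of_nonneg_left (norm_inner_le_norm _ _) (norm_nonneg _)
      · simpa [Pi.sub_def] using hVnp
    have hlim1 : Tendsto (fun n => ∫ x, φ x * ⟪Vn n x, gV x w⟫ ∂ν) atTop
        (𝓝 (∫ x, φ x * ⟪V x, gV x w⟫ ∂ν)) := by
      refine tendsto_integral_of_norm_sub_le_mul (p := p) (q := p') (C := 1)
        (fun n => (hI1 n).1)
        (integrable_of_norm_le_mul (p := p) (q := p') (C := 1)
          (hφc.aestronglyMeasurable.mul (hVmν.inner
            (aestronglyMeasurable_clm_apply hGmν aestronglyMeasurable_const))) hVpν hω₂ fun x => ?_)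
        (fun n => (hVnc n).aestronglyMeasurable) hVmν hω₂ (fun n x => ?_) ?_
      · rw [one_mul, norm_mul, norm_smul, mul_left_comm]
        exact mul_le_mul_of_nonneg_left (norm_inner_le_norm _ _) (norm_nonneg _)
      · rw [← mul_sub, ← inner_sub_left, one_mul, norm_mul, norm_smul, mul_left_comm]
        exact mul_le_mul_of_nonneg_left (norm_inner_le_norm _ _) (norm_nonneg _)
      · simpa [Pi.sub_def] using hVnp
    have hlim2 : Tendsto (fun n => ∫ x, φ x * ⟪V x, fderiv ℝ (Vn n) x w⟫ ∂ν) atTop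
        (𝓝 (∫ x, φ x * ⟪V x, gV x w⟫ ∂ν)) := by
      refine tendsto_integral_of_norm_sub_le_mul (p := p') (q := p) (C := ‖w‖)
        (fun n => (hI2 n).1)
        (integrable_of_norm_le_mul (p := p) (q := p') (C := 1)
          (hφc.aestronglyMeasurable.mul (hVmν.inner
            (aestronglyMeasurable_clm_apply hGmν aestronglyMeasurable_const))) hVpν hω₂ fun x => ?_)
        (fun n => (hDVnc n).aestronglyMeasurable) hGmν hω₃ (fun n x => ?_) ?_
      · rw [one_mul, norm_mul, norm_smul, mul_left_comm]
        exact mul_le_mul_of_nonneg_left (norm_inner_le_norm _ _) (norm_nonneg _)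
      · rw [← mul_sub, ← inner_sub_right, ← sub_apply, norm_mul, norm_smul, real_inner_comm]
        calc ‖φ x‖ * ‖⟪(fderiv ℝ (Vn n) x - gV x) w, V x⟫‖
            ≤ ‖φ x‖ * (‖fderiv ℝ (Vn n) x - gV x‖ * ‖w‖ * ‖V x‖) :=
              mul_le_mul_of_nonneg_left ((norm_inner_le_norm _ _).trans
                (mul_le_mul_of_nonneg_right ((fderiv ℝ (Vn n) x - gV x).le_opNorm w)
                  (norm_nonneg _))) (norm_nonneg _)
          _ = ‖w‖ * (‖fderiv ℝ (Vn n) x - gV x‖ * (‖φ x‖ * ‖V x‖)) := by ring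
      · simpa [Pi.sub_def] using hVnq
    have hEq : ∫ x, (fderiv ℝ φ x w) * ⟪V x, V x⟫ ∂ν = -(2 * ∫ x, φ x * ⟪V x, gV x w⟫ ∂ν) := by
      have h2 := (hlim1.add hlim2).neg
      have h3 := h2.congr fun n => (hstep n).symm
      have := tendsto_nhds_unique hlimL h3
      rw [this]; ring
    -- conclusion
    have hL0 : ∀ x, x ∉ K → (fderiv ℝ φ x w) • (‖V x‖ ^ 2 / 2) = 0 := fun x hx => by
      rw [hDφ0 x hx, zero_apply, zero_smul]
    have hR0 : ∀ x, x ∉ K → φ x • ((innerSL ℝ (V x)).comp (gV x)) w = 0 := fun x hx => by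
      rw [hφ0 x hx, zero_smul]
    rw [setIntegral_eq_setIntegral_of_forall_notMem_eq_zero hL0 hKΩ,
      setIntegral_eq_setIntegral_of_forall_notMem_eq_zero hR0 hKΩ]
    simp only [smul_eq_mul, ContinuousLinearMap.comp_apply, innerSL_apply_apply]
    have e1 : (fun x => fderiv ℝ φ x w * (‖V x‖ ^ 2 / 2)) =
        fun x => (1 / 2 : ℝ) * ((fderiv ℝ φ x w) * ⟪V x, V x⟫) := by
      funext x; rw [real_inner_self_eq_norm_sq]; ring
    rw [e1, integral_const_mul, hEq]
    ring

end NormSq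

end Summit.NavierStokesRegularity.NavierStokesRegularity.Theorems.Wu2026Salvage
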